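import Summits.QuantumFields.YangMills.Theorems.BalabanUVNodesN15CurvedGluingCubeDressedGeneral
import HarnessLib

/-!
# Route «BalabanUVNodes» (cluster K4 «SpineRates»), Track-A DAG node N15 = NE2, LG-VECTOR LAYER AT A LIVE BACKGROUND — THE NONLOCAL LANDAU PERTURBATION `P₁(A)` OF (3.76): the exact
# difference identity for `D_URD_U*`, its decay letter from the printed kernel letters (3.49)∕(3.68), and its slot in file 23's dressed cube (`V̂ := 𝒱∘pr₀`)

Cell `pub-ymgap`, seat `pub-ymgap-dag-n15-w3` (WIDTH SEAT 3∕3 on node N15, director-ym №197 ∕ HUMAN RULING D-0149; plan `W-SEAT-START-LIST.md` §n15 item 3 «LG-vector + background layers at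
GENERAL small-field U» — twenty-seventh piece).  `bears_on: R4∕N15 · K3⁷ SpineGivenEndpointR13SepCoPH (stmt-QuantumFields-20544)`.  Filed `--kind proof --supports stmt-QuantumFields-20544 --as
helper` — COUNT-NEUTRAL.  Theorems only; 0 `sorry`.  Imports BY NAME file 23 `…N15CurvedGluingCubeDressedGeneral` (`hasMaj_dressedV_pair`, `mulOp_comp_sub_comp_dressedV_of_defect`; dag-n15-c B2
`stack`∕`projO`∕`blkPair`∕`projO_none_comp_stack`; lit `hasMaj_comp_exp`, B11 `abs_le_loc_ofBlocks`∕`loc_ofBlocks_le`); nothing in the tree is modified.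

WHY.  The Landau-gauge vector layer's operator at a live background is `Δ_a(U) = Δ(U) + D_UR(U)D_U* + Q*(U)aQ(U)` ([B9] (3.26) p. 395).  Its expansion around `U` ((3.74)–(3.76)
pp. 405–406) produces, besides the local first-order `V₂(A)`, the NONLOCAL `P₁(A) = (D_{U′U} − D_U)P(U)D*_{U′U} + D_UP(U)(D*_{U′U} − D_U*) + D_{U′U}P′(A)D*_{U′U}`, `P′(A) = P(U′U) − P(U)`
— «a non-local operator whose kernel satisfies the bound (3.77)».  THIS FILE types (i) the exact operator identity behind (3.76): for ANY `D₁, D₂ : E₀ → E₁`, `D₁*, D₂* : E₁ → E₀`, `P₁,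
P₂ : E₀ → E₀`, `D₁P₁D₁* − D₂P₂D₂* = (D₁ − D₂)(P₂D₁*) + (D₂P₂)(D₁* − D₂*) + D₁(P₁ − P₂)D₁*`; (ii) its decay letter `Re^{−ρd}` assembled from the DISPLAYED kernel letters — the zero-order
local differences `D₁ − D₂, D₁* − D₂* ≤ ae^{−δd}` (coefficient `O(|A|)`), the printed `P, DP, PD* ≤ pe^{−δd}` ((3.49)) and `DP′D* ≤ qe^{−δd}` ((3.68)); (iii) its slot in file 23: a base operator
`𝒱` (derivatives internal) is the jet perturbation `V̂ := 𝒱∘pr₀` with `V̂∘jet = 𝒱` and the same majorant, so `hasMaj_dressedV_pair` ∕ `mulOp_comp_sub_comp_dressedV_of_defect` apply by name.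

* §1 ★ `landauPert_identity` ((3.76)'s algebra, exact);
* §2 ★★ `hasMaj_landauPert` (the letter `R = a(p + pac_r)c_r + pac_r + q` at rate `ρ`);
* §3 `hasMaj_comp_projO_none` (a base operator read on the jet's `none` component keeps its majorant), `comp_projO_none_jet` (`(𝒱∘pr₀)∘jet = 𝒱`),
  ★★ `hasMaj_dressed_pair_of_base` (the dressed cube pair for a BASE perturbation `𝒱 ≤ Re^{−δ_Vd}`: unit ∧ `X̂ ≤ β(1 − βRc_r²)⁻¹e^{−ρ₂d}`),
  ★★ `mulOp_comp_sub_comp_dressed_of_base` (`hloc` modulo `E`: `M_χ(Δ − 𝒱)X = M_χ + E(1 + 𝒱X)`).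

HONEST FRAMING ∕ LIMITS.  Finite-dimensional algebra + `hasMaj_comp_exp` bookkeeping; the kernel letters (3.49), (3.68), (3.77) are DISPLAYED HYPOTHESES, not proved (their producers are the
flat Landau-term files of dag-n15-a ∕ def-Y and the background expansion of `P`, not in the tree); nothing of [B9] asserted ((3.26), (3.49), (3.68), (3.74)–(3.77) = SHAPES ∕ MECHANISM).  NE2⁺ NOT
PRINTED, NOT proved; N15 NOT discharged; counts of record UNMOVED (typed 28∕28 · discharged 5∕27); one finite 𝕋⁴ at fixed ε — NOT infinite volume, NOT OS on ℝ⁴, NOT a mass gap, NOT Clay; R4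
closes the conditional finite-𝕋⁴ rung `BalabanLadder.UV` only.  Restate-immune (no Theses import).
-/

set_option autoImplicit false

noncomputable section
open scoped BigOperators
open Finset

namespace Summit.QuantumFields.YangMills.BalabanUVNodes.N15.CurvedSpecies

open Literature.MathematicalPhysics.QuantumFieldTheory.Balaban1983to89
open Literature.MathematicalPhysics.QuantumFieldTheory.Balaban1983to89.B11SectG (BlockNorm HasMaj RowSum hasMaj_comp_exp)
open Literature.MathematicalPhysics.QuantumFieldTheory.Balaban1983to89.B6RandomWalk (Triangle254)
open Literature.MathematicalPhysics.QuantumFieldTheory.Balaban1983to89.B11AxialTransport190 (abs_le_loc_ofBlocks loc_ofBlocks_le)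
open Literature.MathematicalPhysics.QuantumFieldTheory.Balaban1983to89.B6Prop26Gluing (mulOp)
open Summit.QuantumFields.YangMills.BalabanUVNodes.N15.MatrixSpecies (liftBlk)
open Summit.QuantumFields.YangMills.BalabanUVNodes.N15.BackgroundModel (kappa_ofBlocks)
open Summit.QuantumFields.YangMills.BalabanUVNodes.N15.BackgroundLayer (stack projO blkPair projO_none_comp_stack bgPropV)

/-! ## §1 The exact difference identity behind (3.76) -/

section Identity

variable {E₀ E₁ : Type} [AddCommGroup E₀] [Module ℝ E₀] [AddCommGroup E₁] [Module ℝ E₁]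

/-- ★ **(3.76)'s ALGEBRA**: `D₁P₁D₁* − D₂P₂D₂* = (D₁ − D₂)∘(P₂∘D₁*) + (D₂∘P₂)∘(D₁* − D₂*) + D₁∘(P₁ − P₂)∘D₁*` for any six linear maps (`D₁ = D_{U′U}`, `D₂ = D_U`, `P₁ = P(U′U)`, `P₂ = P(U)`).
[cite: Balaban1985BackgroundPropagators, (3.76) p.405] -/
theorem landauPert_identity (D₁ D₂ : E₀ →ₗ[ℝ] E₁) (Ds₁ Ds₂ : E₁ →ₗ[ℝ] E₀) (P₁ P₂ : E₀ →ₗ[ℝ] E₀) :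
    D₁ ∘ₗ P₁ ∘ₗ Ds₁ - D₂ ∘ₗ P₂ ∘ₗ Ds₂ = (D₁ - D₂) ∘ₗ (P₂ ∘ₗ Ds₁) + (D₂ ∘ₗ P₂) ∘ₗ (Ds₁ - Ds₂) + D₁ ∘ₗ (P₁ - P₂) ∘ₗ Ds₁ := by
  simp only [LinearMap.sub_comp, LinearMap.comp_sub, LinearMap.comp_assoc]
  abel

end Identity

/-! ## §2 The decay letter of `P₁(A)` from the displayed kernel letters -/

section Letter

variable {Y₀ Y₁ : Type} [Fintype Y₀] [Fintype Y₁] {g : B6.Geometry} (blk₀ : Y₀ → g.Site) (blk₁ : Y₁ → g.Site) {σ cr : ℝ}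

/-- ★★ **THE LETTER OF `P₁(A)`** ((3.77)'s shape from (3.49)∕(3.68)): `D₁ − D₂, D₁* − D₂* ≤ ae^{−δd}`, `P₂, D₂P₂, P₂D₂* ≤ pe^{−δd}`, `D₁(P₁ − P₂)D₁* ≤ qe^{−δd}`, rates `σ ≤ ρ₁`, `ρ₁ + σ ≤ δ`,
`ρ + σ ≤ ρ₁`, `0 ≤ ρ` ⟹ `D₁P₁D₁* − D₂P₂D₂* ≤ (a·(p + p·a·c_r)·c_r + p·a·c_r + q)·e^{−ρd}`. [cite: Balaban1985BackgroundPropagators, (3.49) p.399, (3.68) p.403, (3.76)–(3.77) pp.405–406 (shapes)] -/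
theorem hasMaj_landauPert (htri : Triangle254 g) (hd : ∀ a b : g.Site, 0 ≤ g.dist a b) (hrow : RowSum g σ cr) (hσ : 0 ≤ σ) (hcr : 0 ≤ cr) {δ ρ₁ ρ a p q : ℝ} (ha : 0 ≤ a) (hp : 0 ≤ p)
    (hq : 0 ≤ q) (hσρ : σ ≤ ρ₁) (hρ₁δ : ρ₁ + σ ≤ δ) (hρ : 0 ≤ ρ) (hρρ₁ : ρ + σ ≤ ρ₁) {D₁ D₂ : (Y₀ → ℝ) →ₗ[ℝ] (Y₁ → ℝ)} {Ds₁ Ds₂ : (Y₁ → ℝ) →ₗ[ℝ] (Y₀ → ℝ)}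
    {P₁ P₂ : (Y₀ → ℝ) →ₗ[ℝ] (Y₀ → ℝ)}
    (hD : HasMaj (BlockNorm.ofBlocks g blk₀) (BlockNorm.ofBlocks g blk₁) (D₁ - D₂) (fun y y' => a * Real.exp (-(δ * g.dist y y'))))
    (hDs : HasMaj (BlockNorm.ofBlocks g blk₁) (BlockNorm.ofBlocks g blk₀) (Ds₁ - Ds₂) (fun y y' => a * Real.exp (-(δ * g.dist y y'))))
    (hP : HasMaj (BlockNorm.ofBlocks g blk₀) (BlockNorm.ofBlocks g blk₀) P₂ (fun y y' => p * Real.exp (-(δ * g.dist y y'))))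
    (hDP : HasMaj (BlockNorm.ofBlocks g blk₀) (BlockNorm.ofBlocks g blk₁) (D₂ ∘ₗ P₂) (fun y y' => p * Real.exp (-(δ * g.dist y y'))))
    (hPDs : HasMaj (BlockNorm.ofBlocks g blk₁) (BlockNorm.ofBlocks g blk₀) (P₂ ∘ₗ Ds₂) (fun y y' => p * Real.exp (-(δ * g.dist y y'))))
    (hQ : HasMaj (BlockNorm.ofBlocks g blk₁) (BlockNorm.ofBlocks g blk₁) (D₁ ∘ₗ (P₁ - P₂) ∘ₗ Ds₁) (fun y y' => q * Real.exp (-(δ * g.dist y y')))) :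
    HasMaj (BlockNorm.ofBlocks g blk₁) (BlockNorm.ofBlocks g blk₁) (D₁ ∘ₗ P₁ ∘ₗ Ds₁ - D₂ ∘ₗ P₂ ∘ₗ Ds₂)
      (fun y y' => (a * (p + p * a * cr) * cr + p * a * cr + q) * Real.exp (-(ρ * g.dist y y'))) := by
  have hρ₁ : 0 ≤ ρ₁ := hσ.trans hσρ
  have hρ₁δ' : ρ₁ ≤ δ := by linarith
  have hρδ : ρ ≤ δ := by linarith
  -- `P₂∘D₁* = P₂∘D₂* + P₂∘(D₁* − D₂*) ≤ (p + p·a·c_r)e^{−ρ₁d}`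
  have h1 : HasMaj (BlockNorm.ofBlocks g blk₁) (BlockNorm.ofBlocks g blk₀) (P₂ ∘ₗ (Ds₁ - Ds₂)) (fun y y' => p * a * cr * Real.exp (-(ρ₁ * g.dist y y'))) := by
    refine (hasMaj_comp_exp htri hd hrow hp ha hρ₁ hρ₁δ' hρ₁δ hP hDs).mono fun y y' => le_of_eq ?_
    rw [kappa_ofBlocks]; ring
  have hPDs₁ : HasMaj (BlockNorm.ofBlocks g blk₁) (BlockNorm.ofBlocks g blk₀) (P₂ ∘ₗ Ds₁) (fun y y' => (p + p * a * cr) * Real.exp (-(ρ₁ * g.dist y y'))) := by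
    have hsplit : P₂ ∘ₗ Ds₁ = P₂ ∘ₗ Ds₂ + P₂ ∘ₗ (Ds₁ - Ds₂) := by rw [LinearMap.comp_sub]; abel
    have hPDs' : HasMaj (BlockNorm.ofBlocks g blk₁) (BlockNorm.ofBlocks g blk₀) (P₂ ∘ₗ Ds₂) (fun y y' => p * Real.exp (-(ρ₁ * g.dist y y'))) :=
      hPDs.mono fun y y' => mul_le_mul_of_nonneg_left (Real.exp_le_exp.mpr (by nlinarith [hd y y'])) hp
    rw [hsplit]
    refine (hPDs'.add h1).mono fun y y' => le_of_eq ?_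
    ring
  -- the three terms of the identity at rate `ρ`
  have hpa : 0 ≤ p + p * a * cr := by positivity
  have t1 : HasMaj (BlockNorm.ofBlocks g blk₁) (BlockNorm.ofBlocks g blk₁) ((D₁ - D₂) ∘ₗ (P₂ ∘ₗ Ds₁)) (fun y y' => a * (p + p * a * cr) * cr * Real.exp (-(ρ * g.dist y y'))) := by
    refine (hasMaj_comp_exp htri hd hrow ha hpa hρ (by linarith) (by linarith) hD hPDs₁).mono fun y y' => le_of_eq ?_
    rw [kappa_ofBlocks]; ring
  have t2 : HasMaj (BlockNorm.ofBlocks g blk₁) (BlockNorm.ofBlocks g blk₁) ((D₂ ∘ₗ P₂) ∘ₗ (Ds₁ - Ds₂)) (fun y y' => p * a * cr * Real.exp (-(ρ * g.dist y y'))) := by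
    refine (hasMaj_comp_exp htri hd hrow hp ha hρ hρδ (by linarith) hDP hDs).mono fun y y' => le_of_eq ?_
    rw [kappa_ofBlocks]; ring
  have t3 : HasMaj (BlockNorm.ofBlocks g blk₁) (BlockNorm.ofBlocks g blk₁) (D₁ ∘ₗ (P₁ - P₂) ∘ₗ Ds₁) (fun y y' => q * Real.exp (-(ρ * g.dist y y'))) :=
    hQ.mono fun y y' => mul_le_mul_of_nonneg_left (Real.exp_le_exp.mpr (by nlinarith [hd y y'])) hq
  rw [landauPert_identity]
  refine ((t1.add t2).add t3).mono fun y y' => le_of_eq ?_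
  ring

end Letter

/-! ## §3 The slot in the dressed cube: a base perturbation read on the jet's `none` component -/

section Slot

variable {X ι J : Type} [Fintype X] [DecidableEq X] [Fintype ι] [DecidableEq ι] [Fintype J] [DecidableEq J] {g : B6.Geometry} (blk : X → g.Site) {σ cr : ℝ}
  {G₀ : (X × ι → ℝ) →ₗ[ℝ] (X × ι → ℝ)} {D Dq : J ⊕ J → (X × ι → ℝ) →ₗ[ℝ] (X × ι → ℝ)} {𝒱 : (X × ι → ℝ) →ₗ[ℝ] (X × ι → ℝ)}

omit [DecidableEq X] [DecidableEq ι] [DecidableEq J] in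
/-- a base operator read on the `none` component of the jet keeps its (nonnegative) majorant. [folklore] -/
theorem hasMaj_comp_projO_none {F : Type} [AddCommGroup F] [Module ℝ F] {b₂ : BlockNorm g F} {T : (X × ι → ℝ) →ₗ[ℝ] F} {K : g.Site → g.Site → ℝ} (hK : ∀ a b, 0 ≤ K a b)
    (hT : HasMaj (BlockNorm.ofBlocks g (liftBlk blk ι)) b₂ T K) :
    HasMaj (BlockNorm.ofBlocks g (blkPair (liftBlk blk ι))) b₂ (T ∘ₗ projO (none : Option (J ⊕ J))) K := by
  intro y' v hv y
  have hv' : ∀ q : (X × ι) × Option (J ⊕ J), liftBlk blk ι q.1 ≠ y' → v q = 0 := hv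
  have hloc : (BlockNorm.ofBlocks g (liftBlk blk ι)).IsLoc y' (projO (none : Option (J ⊕ J)) v) := fun p hp => hv' (p, none) hp
  have hle : (BlockNorm.ofBlocks g (liftBlk blk ι)).loc y' (projO (none : Option (J ⊕ J)) v) ≤ (BlockNorm.ofBlocks g (blkPair (liftBlk blk ι))).loc y' v :=
    loc_ofBlocks_le (liftBlk blk ι) _ ((BlockNorm.ofBlocks g (blkPair (J := J ⊕ J) (liftBlk blk ι))).loc_nonneg _ _) fun p hp =>
      abs_le_loc_ofBlocks (blkPair (liftBlk blk ι)) v (x' := (p, none)) hp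
  rw [LinearMap.comp_apply]
  exact (hT y' _ hloc y).trans (mul_le_mul_of_nonneg_left hle (hK _ _))

omit [Fintype X] [DecidableEq X] [Fintype ι] [DecidableEq ι] [Fintype J] [DecidableEq J] in
/-- `(𝒱∘pr₀)∘jet = 𝒱`. [folklore] -/
theorem comp_projO_none_jet : (𝒱 ∘ₗ projO none) ∘ₗ stack LinearMap.id Dq = 𝒱 := by
  rw [LinearMap.comp_assoc, projO_none_comp_stack, LinearMap.comp_id]

/-- ★★ **THE DRESSED CUBE PAIR FOR A BASE PERTURBATION** (e.g. `𝒱 = P₁(A)` with §2's letter, or the whole `V(A)`): `G₀, D_j ≤ βe^{−δd}`, `𝒱 ≤ Re^{−δ_Vd}`, `βRc_r² < 1` ⟹ the unit holds and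
`X̂ = (1 − Ŝ(𝒱∘pr₀))⁻¹Ŝ ≤ β(1 − βRc_r²)⁻¹e^{−ρ₂d}` (file 23 `hasMaj_dressedV_pair` at `V̂ := 𝒱∘pr₀`). [cite: Balaban1985BackgroundPropagators, (3.63)–(3.64) pp.402–403, (3.76)–(3.77) pp.405–406] -/
theorem hasMaj_dressed_pair_of_base (htri : Triangle254 g) (hd : ∀ a b : g.Site, 0 ≤ g.dist a b) (hrow : RowSum g σ cr) (hσ : 0 ≤ σ) {ρ₁ ρ₂ δ δV β R : ℝ} (hβ : 0 ≤ β)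
    (hR : 0 ≤ R) (hcr : 0 ≤ cr) (hσρ : σ ≤ ρ₁) (hρ₁V : ρ₁ ≤ δV) (hρ₁G : ρ₁ + σ ≤ δ) (hρ₂ : 0 ≤ ρ₂) (hρ₂₁ : ρ₂ + σ ≤ ρ₁)
    (hG : HasMaj (BlockNorm.ofBlocks g (liftBlk blk ι)) (BlockNorm.ofBlocks g (liftBlk blk ι)) G₀ (fun y y' => β * Real.exp (-(δ * g.dist y y'))))
    (hD : ∀ j, HasMaj (BlockNorm.ofBlocks g (liftBlk blk ι)) (BlockNorm.ofBlocks g (liftBlk blk ι)) (D j) (fun y y' => β * Real.exp (-(δ * g.dist y y'))))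
    (hV : HasMaj (BlockNorm.ofBlocks g (liftBlk blk ι)) (BlockNorm.ofBlocks g (liftBlk blk ι)) 𝒱 (fun y y' => R * Real.exp (-(δV * g.dist y y')))) (hq : β * (R * cr) * cr < 1) :
    IsUnit (1 - LinearMap.toMatrix' (stack G₀ D ∘ₗ (𝒱 ∘ₗ projO (none : Option (J ⊕ J))))) ∧
      HasMaj (BlockNorm.ofBlocks g (liftBlk blk ι)) (BlockNorm.ofBlocks g (blkPair (liftBlk blk ι))) (bgPropV (stack G₀ D) (𝒱 ∘ₗ projO (none : Option (J ⊕ J))))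
        (fun y y' => β * (1 - β * (R * cr) * cr)⁻¹ * Real.exp (-(ρ₂ * g.dist y y'))) :=
  hasMaj_dressedV_pair blk htri hd hrow hσ hβ hR hcr hσρ hρ₁V hρ₁G hρ₂ hρ₂₁ hG hD (hasMaj_comp_projO_none blk (fun _ _ => mul_nonneg hR (Real.exp_nonneg _)) hV) hq

/-- ★★ **`hloc` MODULO A DEFECT FOR A BASE PERTURBATION**: `M_χΔG₀ = M_χ + E`, `D_j = Dq_j∘G₀` ⟹ `M_χ∘(Δ − 𝒱)∘X = M_χ + E∘(1 + 𝒱∘X)`, `X = pr₀X̂` (file 23 at `V̂ := 𝒱∘pr₀`, `(𝒱∘pr₀)∘jet = 𝒱`).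
[cite: Balaban1984PropagatorsII, (2.91) p.239 (mechanism); Balaban1985BackgroundPropagators, (3.62)–(3.65) pp.402–403, (3.76) p.405] -/
theorem mulOp_comp_sub_comp_dressed_of_base (Δ Ed : (X × ι → ℝ) →ₗ[ℝ] (X × ι → ℝ)) (χ : X × ι → ℝ) (hloc : mulOp χ ∘ₗ Δ ∘ₗ G₀ = mulOp χ + Ed) (hDq : ∀ j, D j = Dq j ∘ₗ G₀)
    (hunit : IsUnit (1 - LinearMap.toMatrix' (stack G₀ D ∘ₗ (𝒱 ∘ₗ projO (none : Option (J ⊕ J)))))) :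
    mulOp χ ∘ₗ (Δ - 𝒱) ∘ₗ (projO none ∘ₗ bgPropV (stack G₀ D) (𝒱 ∘ₗ projO (none : Option (J ⊕ J)))) =
      mulOp χ + Ed ∘ₗ (LinearMap.id + 𝒱 ∘ₗ (projO none ∘ₗ bgPropV (stack G₀ D) (𝒱 ∘ₗ projO (none : Option (J ⊕ J))))) := by
  have key := mulOp_comp_sub_comp_dressedV_of_defect (V := 𝒱 ∘ₗ projO (none : Option (J ⊕ J))) Δ Ed χ hloc hDq hunit
  rwa [comp_projO_none_jet] at key

end Slot

end Summit.QuantumFields.YangMills.BalabanUVNodes.N15.CurvedSpecies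

end
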